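import Summits.SmoothPoincare4.SmoothPoincare4.Theorems.ConvexBisectionAcyclicBisectionExistsStabilisationData
import Literature.Topology.FourManifolds.HandleAttachingMapsExistence
import HarnessLib

/-!
# N3 (`stub_STgeo`) ▸ N3-nat ▸ pieces N3d-3, N3d-4/5/6: INTERFACE VOCABULARY OF THE SUB-PIECES — the traces
# of the handlebody side and of the cap side, the dualised model — and the SHORT-FORM contracts
(wave 8, brick J7-6 of stub `stub_STgeo` = node N3 of NF4, line `modp-braid-orbits`, crux
`ConvexBisection.AcyclicBisectionExists`, item stmt-SmoothPoincare4-10508; registered sub-goal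
`helper_node_trade_of_short_subpieces`; design file `work/design/N3d_Pieces_Design.lean` (J7, wave 8) §B, §D.)

The sub-pieces (B1) `piece3_handlebodySide`, (B2) `piece3_capSide`, (B3) `piece3_gluing` of N3d-3 and (T2)
`piece4_respaceDuals` of N3d-4/5/6 have closed texts of 4.1–7.3 k characters (over the registration limit);
this file names their recurring blocks as documented predicates so that they can be registered in SHORT FORM,
and proves the corresponding short-form contracts (same proofs as the long-form contracts of
`…StabRebaseContract.lean`, `…StabTradeContract.lean`; the predicates unfold definitionally to the long texts):
* `NormalisedWitness M g l S X h D bX Ψ` — the seven clauses of `NormalisedDatum` on GIVEN data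
  (`normalisedDatum_iff`); `CancelOffModel S V DV Λ` — "`Λ : V ≅ Base g` is canonical off the model region"
  (the body of the N3d-2 text);
* `HandlebodySideTrace S h D V DV Λ X₁ hold D₁ GX` — the four link clauses of `hold` and the traces (t1)(t2)(t3)
  of `G_X : X₁ ≅ X` (output of (B1)); `CapSideTrace S h D bX Ψ V DV Λ W₂ q' D₂ Ξ` — (u-off)(u-seam)(u-belt)
  (u-glue) of `Ξ : W₂ ≅ Base g` (output of (B2));
* `DualisedModel M g l c d` — a fibred datum of `M` over `Base (g+1)` indexed by `Fin 4 ⊕ Fin n`, block curves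
  in the pages of directions `d : Fin 4 → ℂ` with shadows `(a, a, b, b)` and twistings `(−1, 1, −1, 1)`, old
  handles at `pageDir (n+4) (k+4)`, gluing and seam clause (interface of (T1) → (T2) → (T3));
* `node_rebase_of_short_subpieces`, `node_trade_of_short_subpieces` (registered helper) — PROVED.
Short registration texts: `work/stubs/sig_piece3_*_short.txt`, `sig_piece4_*_short.txt`.
References: J. B. Etnyre, T. Fuller, IMRN 2006, §2 [EtnyreFuller2006]; R. İ. Baykur, AGT 6 (2006), §5
[Baykur2006].
-/

noncomputable section

-- the prescribed namespace `Summit.<P>.<Sub>.…` duplicates `SmoothPoincare4` (P = Sub)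
set_option linter.dupNamespace false

open scoped Manifold ContDiff Topology Real
open Set Function

namespace Summit.SmoothPoincare4.SmoothPoincare4.Theorems.AcyclicBisectionExists.ModpBraidOrbits

open Literature.GroupTheory.CombinatorialGroupTheory.SignedHurwitz
open Literature.Topology.FourManifolds Literature.Topology.FourManifolds.LefschetzBase
open Literature.Topology.FourManifolds.HandleAttachingMap
open Literature.Geometry.Symplectic

/-! ## §1 The normalised datum on given data; the cancellation clause -/

/-- **The seven clauses of `NormalisedDatum M g l S` on GIVEN data `(X, h, D, bX, Ψ)`** (pages
`pageDir (n+4)(k+4)`, shadows, twistings, ranges off the block sector and inside `‖cx‖² < 4 − ε₁`, gluing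
of `M`, seam clause, seam map `= id` on the binding tube). [cite: EtnyreFuller2006, §2] -/
def NormalisedWitness (M : Type) [TopologicalSpace M] [ChartedSpace (EuclideanSpace ℝ (Fin 4)) M]
    (g : ℕ) (l : IntWord g) {c : Fin g ⊕ Fin g → ℤ} (S : StabBaseData g l.length c)
    (X : Type) [TopologicalSpace X] [ChartedSpace (EuclideanHalfSpace 4) X]
    (h : Fin l.length → HandleAttachingMap 3 2 (Base g)) (D : MultiAttachmentData h (𝓡∂ 4) X)
    (bX : BoundaryData (𝓡∂ 4) X (𝓡 3)) (Ψ : bX.carrier ≃ₘ⟮𝓡 3, 𝓡 3⟯ (bBase g).carrier) : Prop :=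
  (∀ (i : Fin l.length) θ, (h i).attachingCircle θ ∈ page g (pageDir (l.length + 4) (i + 4))) ∧
  (∀ i, shadow g (h i).attachingCircle (h i).continuous_attachingCircle = (l.get i).1) ∧
  (∀ i, pageTwisting g (h i).attachingCircle (h i).attachingFraming = if (l.get i).2 then -1 else 1) ∧
  (∀ i y, w g ((h i).toFun y).1 ∉ blockSector l.length ∧ ‖cx ((h i).toFun y).1‖ ^ 2 < 4 - S.ε₁) ∧
  IsBoundaryGluing bX (bBase g) Ψ (𝓡 4) M ∧
  (∀ (y : bX.carrier) (a : ↥(coresComplement h)), bX.incl y = D.jA a →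
  ∃ r : ℝ, 0 < r ∧ w g ((bBase g).incl (Ψ y)).1 = (r : ℂ) * w g (a : Base g).1) ∧
  (∀ (y : bX.carrier) (a : ↥(coresComplement h)),
  bX.incl y = D.jA a → 4 - S.ε₁ < ‖cx (a : Base g).1‖ ^ 2 → (bBase g).incl (Ψ y) = (a : Base g))

/-- `NormalisedDatum` is the existence of data with `NormalisedWitness` (definitional). [folklore] -/
theorem normalisedDatum_iff (M : Type) [TopologicalSpace M] [ChartedSpace (EuclideanSpace ℝ (Fin 4)) M]
    (g : ℕ) (l : IntWord g) {c : Fin g ⊕ Fin g → ℤ} (S : StabBaseData g l.length c) :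
    NormalisedDatum M g l S ↔
      ∃ (X : Type) (_ : TopologicalSpace X) (_ : T2Space X) (_ : SecondCountableTopology X)
        (_ : CompactSpace X) (_ : ChartedSpace (EuclideanHalfSpace 4) X) (_ : IsManifold (𝓡∂ 4) ∞ X)
        (h : Fin l.length → HandleAttachingMap 3 2 (Base g)) (D : MultiAttachmentData h (𝓡∂ 4) X)
        (bX : BoundaryData (𝓡∂ 4) X (𝓡 3)) (Ψ : bX.carrier ≃ₘ⟮𝓡 3, 𝓡 3⟯ (bBase g).carrier),
        NormalisedWitness M g l S X h D bX Ψ :=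
  Iff.rfl

/-- **"`Λ : V ≅ Base g` is the canonical identification off the model region"** — the body of the N3d-2 text
`node_cancel` for ONE model `V` of `Base (g+1) ∪ qA ∪ qB`. [cite: Kosinski1993, VI (7.4)] -/
def CancelOffModel {g n : ℕ} {c : Fin g ⊕ Fin g → ℤ} (S : StabBaseData g n c)
    (V : Type) [TopologicalSpace V] [ChartedSpace (EuclideanHalfSpace 4) V]
    (DV : MultiAttachmentData ![S.qA, S.qB] (𝓡∂ 4) V) (Λ : V ≃ₘ⟮𝓡∂ 4, 𝓡∂ 4⟯ Base g) : Prop :=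
  ∀ (a : ↥(coresComplement S.q1)) (ha : S.E.jA a ∈ coresComplement ![S.qA, S.qB]),
    (a : Base g) ∉ modelRegion g n S.δ₀ S.ε₁ → Λ (DV.jA ⟨S.E.jA a, ha⟩) = (a : Base g)

/-! ## §2 The traces of the handlebody side and of the cap side (N3d-3) -/

/-- **Output of (B1): the handlebody-side piece `X₁` with traces** — the four link clauses of the re-planted
old handles `hold` and the traces of `G_X : X₁ ≅ X`: (t1) `G_X ∘ D₁.jA = D.jA ∘ Λ ∘ DV.jA` on base points of
`V`, (t2) `G_X ∘ D₁.jB (inl i) = D.jA ∘ Λ ∘ DV.jB i` on the block handles, (t3) `G_X ∘ D₁.jB (inr k) = D.jB k`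
on the old handles. [cite: EtnyreFuller2006, §2] -/
def HandlebodySideTrace {g : ℕ} {l : IntWord g} {c : Fin g ⊕ Fin g → ℤ} (S : StabBaseData g l.length c)
    {X : Type} [TopologicalSpace X] [ChartedSpace (EuclideanHalfSpace 4) X]
    (h : Fin l.length → HandleAttachingMap 3 2 (Base g)) (D : MultiAttachmentData h (𝓡∂ 4) X)
    {V : Type} [TopologicalSpace V] [ChartedSpace (EuclideanHalfSpace 4) V]
    (DV : MultiAttachmentData ![S.qA, S.qB] (𝓡∂ 4) V) (Λ : V ≃ₘ⟮𝓡∂ 4, 𝓡∂ 4⟯ Base g)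
    {X₁ : Type} [TopologicalSpace X₁] [ChartedSpace (EuclideanHalfSpace 4) X₁]
    (hold : Fin l.length → HandleAttachingMap 3 2 (Base (g + 1)))
    (D₁ : MultiAttachmentData (Sum.elim ![S.qA, S.qB] hold) (𝓡∂ 4) X₁) (GX : X₁ ≃ₘ⟮𝓡∂ 4, 𝓡∂ 4⟯ X) : Prop :=
  (∀ (k : Fin l.length) θ, (hold k).attachingCircle θ ∈ page (g + 1) (pageDir (l.length + 4) (k + 4))) ∧
  (∀ k, shadow (g + 1) (hold k).attachingCircle (hold k).continuous_attachingCircle =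
    embed g (l.get k).1) ∧
  (∀ k, pageTwisting (g + 1) (hold k).attachingCircle (hold k).attachingFraming =
    if (l.get k).2 then -1 else 1) ∧
  (∀ k y, w (g + 1) ((hold k).toFun y).1 ∉ blockSector l.length) ∧
  (∀ (x : ↥(coresComplement ![S.qA, S.qB]))
    (hx : (x : Base (g + 1)) ∈ coresComplement (Sum.elim ![S.qA, S.qB] hold)),
    ∃ hΛ : Λ (DV.jA x) ∈ coresComplement h, GX (D₁.jA ⟨x, hx⟩) = D.jA ⟨Λ (DV.jA x), hΛ⟩) ∧
  (∀ (i : Fin 2) (b : ↥(beltPiece 3 2)),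
    ∃ hΛ : Λ (DV.jB i b) ∈ coresComplement h, GX (D₁.jB (Sum.inl i) b) = D.jA ⟨Λ (DV.jB i b), hΛ⟩) ∧
  (∀ (k : Fin l.length) (b : ↥(beltPiece 3 2)), GX (D₁.jB (Sum.inr k) b) = D.jB k b)

/-- **Output of (B2): the cap-side piece `W₂` with traces** of `Ξ : W₂ ≅ Base g`: (u-off) canonical off the
model region; (u-seam) `Ξ⁻¹ ∘ e ∘ Λ` on seam points over base points of `V`, direction-preserving; (u-belt)
the same on the block handles (the matching); (u-glue) correspondence of the glue relations.
[cite: EtnyreFuller2006, §2] -/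
def CapSideTrace {g : ℕ} {l : IntWord g} {c : Fin g ⊕ Fin g → ℤ} (S : StabBaseData g l.length c)
    {X : Type} [TopologicalSpace X] [ChartedSpace (EuclideanHalfSpace 4) X]
    (h : Fin l.length → HandleAttachingMap 3 2 (Base g)) (D : MultiAttachmentData h (𝓡∂ 4) X)
    (bX : BoundaryData (𝓡∂ 4) X (𝓡 3)) (Ψ : bX.carrier ≃ₘ⟮𝓡 3, 𝓡 3⟯ (bBase g).carrier)
    {V : Type} [TopologicalSpace V] [ChartedSpace (EuclideanHalfSpace 4) V]
    (DV : MultiAttachmentData ![S.qA, S.qB] (𝓡∂ 4) V) (Λ : V ≃ₘ⟮𝓡∂ 4, 𝓡∂ 4⟯ Base g)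
    {W₂ : Type} [TopologicalSpace W₂] [ChartedSpace (EuclideanHalfSpace 4) W₂]
    (q' : Fin 2 → HandleAttachingMap 3 2 (Base (g + 1))) (D₂ : MultiAttachmentData q' (𝓡∂ 4) W₂)
    (Ξ : W₂ ≃ₘ⟮𝓡∂ 4, 𝓡∂ 4⟯ Base g) : Prop :=
  (∀ (q : ↥(coresComplement S.q1)), (q : Base g) ∉ modelRegion g l.length S.δ₀ S.ε₁ →
    ∃ hq : S.E.jA q ∈ coresComplement q', Ξ (D₂.jA ⟨S.E.jA q, hq⟩) = (q : Base g)) ∧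
  (∀ (x : ↥(coresComplement ![S.qA, S.qB])) (hΛ : Λ (DV.jA x) ∈ coresComplement h)
    (y₀ : bX.carrier), bX.incl y₀ = D.jA ⟨Λ (DV.jA x), hΛ⟩ →
    ∃ (a' : ↥(coresComplement q')) (r : ℝ), 0 < r ∧ Ξ.symm ((bBase g).incl (Ψ y₀)) = D₂.jA a' ∧
      w (g + 1) (a' : Base (g + 1)).1 = (r : ℂ) * w (g + 1) (x : Base (g + 1)).1) ∧
  (∀ (i : Fin 2) (b : ↥(beltPiece 3 2)) (hΛ : Λ (DV.jB i b) ∈ coresComplement h) (y₀ : bX.carrier),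
    bX.incl y₀ = D.jA ⟨Λ (DV.jB i b), hΛ⟩ → Ξ.symm ((bBase g).incl (Ψ y₀)) = D₂.jB i b) ∧
  (∀ (i : Fin 2) (b : ↥(beltPiece 3 2)), (∃ x', D₂.jA x' = D₂.jB i b) ↔ ∃ x, DV.jA x = DV.jB i b)

/-! ## §3 The dualised model (N3d-4/5/6) -/

/-- **The dualised fibred model of `M` over `Base (g+1)` with block directions `d`**: family indexed by
`Fin 4 ⊕ Fin n` (block order `A, A*, B, B*`; shadows `a, a, b, b` with `a = newE g + embed g c`, `b = newF g`;
page twistings `−1, 1, −1, 1`; circles in the pages of directions `d i`), old handles at `pageDir (n+4)(k+4)`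
with shadows `embed` and the old twistings, a gluing of `M` and the seam clause at genus `g+1` — the output
of the trade + re-dig (T1) (directions next to `pageDir 0`, `pageDir 2`) and of the re-spacing (T2)
(`d i = pageDir (n+4) i`), the input of the finish (T3). [cite: Baykur2006, §5 p. 13] -/
def DualisedModel (M : Type) [TopologicalSpace M] [ChartedSpace (EuclideanSpace ℝ (Fin 4)) M]
    (g : ℕ) (l : IntWord g) (c : Fin g ⊕ Fin g → ℤ) (d : Fin 4 → ℂ) : Prop :=
  ∃ (X'' : Type) (_ : TopologicalSpace X'') (_ : T2Space X'') (_ : SecondCountableTopology X'')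
  (_ : CompactSpace X'') (_ : ChartedSpace (EuclideanHalfSpace 4) X'') (_ : IsManifold (𝓡∂ 4) ∞ X'')
  (h'' : Fin 4 ⊕ Fin l.length → HandleAttachingMap 3 2 (Base (g + 1)))
  (D'' : MultiAttachmentData h'' (𝓡∂ 4) X'') (bX'' : BoundaryData (𝓡∂ 4) X'' (𝓡 3))
  (Ψ'' : bX''.carrier ≃ₘ⟮𝓡 3, 𝓡 3⟯ (bBase (g + 1)).carrier),
  (∀ (i : Fin 4) θ, (h'' (Sum.inl i)).attachingCircle θ ∈ page (g + 1) (d i)) ∧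
  (∀ (k : Fin l.length) θ, (h'' (Sum.inr k)).attachingCircle θ ∈
    page (g + 1) (pageDir (l.length + 4) (k + 4))) ∧
  (∀ i, shadow (g + 1) (h'' (Sum.inl i)).attachingCircle (h'' (Sum.inl i)).continuous_attachingCircle =
    ![newE g + embed g c, newE g + embed g c, newF g, newF g] i) ∧
  (∀ k, shadow (g + 1) (h'' (Sum.inr k)).attachingCircle (h'' (Sum.inr k)).continuous_attachingCircle =
    embed g (l.get k).1) ∧
  (∀ i, pageTwisting (g + 1) (h'' (Sum.inl i)).attachingCircle (h'' (Sum.inl i)).attachingFraming =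
    ![(-1 : ℤ), 1, -1, 1] i) ∧
  (∀ k, pageTwisting (g + 1) (h'' (Sum.inr k)).attachingCircle (h'' (Sum.inr k)).attachingFraming =
    if (l.get k).2 then -1 else 1) ∧
  IsBoundaryGluing bX'' (bBase (g + 1)) Ψ'' (𝓡 4) M ∧
  (∀ (y : bX''.carrier) (a : ↥(coresComplement h'')), bX''.incl y = D''.jA a →
    ∃ r : ℝ, 0 < r ∧ w (g + 1) ((bBase (g + 1)).incl (Ψ'' y)).1 = (r : ℂ) * w (g + 1) (a : Base (g + 1)).1)

/-! ## §4 The short-form contracts -/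

/-- **CONTRACT N3d-3 (short form): `node_rebase` from (B1), (B2), (B3) stated through the vocabulary**
(`NormalisedWitness`, `CancelOffModel`, `HandlebodySideTrace`, `CapSideTrace`): unpack the normalised datum,
take one block model `V` (Kosinski's simultaneous attachment of `![S.qA, S.qB]`) and its cancellation, chain.
[cite: EtnyreFuller2006, §2] -/
theorem node_rebase_of_short_subpieces
    (hB1 : ∀ (M : Type) [TopologicalSpace M] [T2Space M] [SecondCountableTopology M]
        [ChartedSpace (EuclideanSpace ℝ (Fin 4)) M] [IsManifold (𝓡 4) ∞ M] (g : ℕ) (l : IntWord g)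
        (c : Fin g ⊕ Fin g → ℤ) (S : StabBaseData g l.length c)
        (X : Type) [TopologicalSpace X] [T2Space X] [SecondCountableTopology X] [CompactSpace X]
        [ChartedSpace (EuclideanHalfSpace 4) X] [IsManifold (𝓡∂ 4) ∞ X]
        (h : Fin l.length → HandleAttachingMap 3 2 (Base g)) (D : MultiAttachmentData h (𝓡∂ 4) X)
        (bX : BoundaryData (𝓡∂ 4) X (𝓡 3)) (Ψ : bX.carrier ≃ₘ⟮𝓡 3, 𝓡 3⟯ (bBase g).carrier),
        NormalisedWitness M g l S X h D bX Ψ →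
        ∀ (V : Type) [TopologicalSpace V] [T2Space V] [SecondCountableTopology V] [CompactSpace V]
          [ChartedSpace (EuclideanHalfSpace 4) V] [IsManifold (𝓡∂ 4) ∞ V]
          (DV : MultiAttachmentData ![S.qA, S.qB] (𝓡∂ 4) V) (Λ : V ≃ₘ⟮𝓡∂ 4, 𝓡∂ 4⟯ Base g),
        CancelOffModel S V DV Λ →
        ∃ (X₁ : Type) (_ : TopologicalSpace X₁) (_ : T2Space X₁) (_ : SecondCountableTopology X₁)
          (_ : CompactSpace X₁) (_ : ChartedSpace (EuclideanHalfSpace 4) X₁) (_ : IsManifold (𝓡∂ 4) ∞ X₁)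
          (hold : Fin l.length → HandleAttachingMap 3 2 (Base (g + 1)))
          (D₁ : MultiAttachmentData (Sum.elim ![S.qA, S.qB] hold) (𝓡∂ 4) X₁) (GX : X₁ ≃ₘ⟮𝓡∂ 4, 𝓡∂ 4⟯ X),
          HandlebodySideTrace S h D DV Λ hold D₁ GX)
    (hB2 : ∀ (M : Type) [TopologicalSpace M] [T2Space M] [SecondCountableTopology M]
        [ChartedSpace (EuclideanSpace ℝ (Fin 4)) M] [IsManifold (𝓡 4) ∞ M] (g : ℕ) (l : IntWord g)
        (c : Fin g ⊕ Fin g → ℤ) (S : StabBaseData g l.length c)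
        (X : Type) [TopologicalSpace X] [T2Space X] [SecondCountableTopology X] [CompactSpace X]
        [ChartedSpace (EuclideanHalfSpace 4) X] [IsManifold (𝓡∂ 4) ∞ X]
        (h : Fin l.length → HandleAttachingMap 3 2 (Base g)) (D : MultiAttachmentData h (𝓡∂ 4) X)
        (bX : BoundaryData (𝓡∂ 4) X (𝓡 3)) (Ψ : bX.carrier ≃ₘ⟮𝓡 3, 𝓡 3⟯ (bBase g).carrier),
        NormalisedWitness M g l S X h D bX Ψ →
        ∀ (V : Type) [TopologicalSpace V] [T2Space V] [SecondCountableTopology V] [CompactSpace V]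
          [ChartedSpace (EuclideanHalfSpace 4) V] [IsManifold (𝓡∂ 4) ∞ V]
          (DV : MultiAttachmentData ![S.qA, S.qB] (𝓡∂ 4) V) (Λ : V ≃ₘ⟮𝓡∂ 4, 𝓡∂ 4⟯ Base g),
        CancelOffModel S V DV Λ →
        ∃ (W₂ : Type) (_ : TopologicalSpace W₂) (_ : T2Space W₂) (_ : SecondCountableTopology W₂)
          (_ : CompactSpace W₂) (_ : ChartedSpace (EuclideanHalfSpace 4) W₂) (_ : IsManifold (𝓡∂ 4) ∞ W₂)
          (q' : Fin 2 → HandleAttachingMap 3 2 (Base (g + 1))) (D₂ : MultiAttachmentData q' (𝓡∂ 4) W₂)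
          (Ξ : W₂ ≃ₘ⟮𝓡∂ 4, 𝓡∂ 4⟯ Base g),
          CapSideTrace S h D bX Ψ DV Λ q' D₂ Ξ)
    (hB3 : ∀ (M : Type) [TopologicalSpace M] [T2Space M] [SecondCountableTopology M]
        [ChartedSpace (EuclideanSpace ℝ (Fin 4)) M] [IsManifold (𝓡 4) ∞ M] (g : ℕ) (l : IntWord g)
        (c : Fin g ⊕ Fin g → ℤ) (S : StabBaseData g l.length c)
        (X : Type) [TopologicalSpace X] [T2Space X] [SecondCountableTopology X] [CompactSpace X]
        [ChartedSpace (EuclideanHalfSpace 4) X] [IsManifold (𝓡∂ 4) ∞ X]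
        (h : Fin l.length → HandleAttachingMap 3 2 (Base g)) (D : MultiAttachmentData h (𝓡∂ 4) X)
        (bX : BoundaryData (𝓡∂ 4) X (𝓡 3)) (Ψ : bX.carrier ≃ₘ⟮𝓡 3, 𝓡 3⟯ (bBase g).carrier),
        NormalisedWitness M g l S X h D bX Ψ →
        ∀ (V : Type) [TopologicalSpace V] [T2Space V] [SecondCountableTopology V] [CompactSpace V]
          [ChartedSpace (EuclideanHalfSpace 4) V] [IsManifold (𝓡∂ 4) ∞ V]
          (DV : MultiAttachmentData ![S.qA, S.qB] (𝓡∂ 4) V) (Λ : V ≃ₘ⟮𝓡∂ 4, 𝓡∂ 4⟯ Base g),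
        CancelOffModel S V DV Λ →
        ∀ (X₁ : Type) [TopologicalSpace X₁] [T2Space X₁] [SecondCountableTopology X₁] [CompactSpace X₁]
          [ChartedSpace (EuclideanHalfSpace 4) X₁] [IsManifold (𝓡∂ 4) ∞ X₁]
          (hold : Fin l.length → HandleAttachingMap 3 2 (Base (g + 1)))
          (D₁ : MultiAttachmentData (Sum.elim ![S.qA, S.qB] hold) (𝓡∂ 4) X₁) (GX : X₁ ≃ₘ⟮𝓡∂ 4, 𝓡∂ 4⟯ X),
        HandlebodySideTrace S h D DV Λ hold D₁ GX →
        ∀ (W₂ : Type) [TopologicalSpace W₂] [T2Space W₂] [SecondCountableTopology W₂] [CompactSpace W₂]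
          [ChartedSpace (EuclideanHalfSpace 4) W₂] [IsManifold (𝓡∂ 4) ∞ W₂]
          (q' : Fin 2 → HandleAttachingMap 3 2 (Base (g + 1))) (D₂ : MultiAttachmentData q' (𝓡∂ 4) W₂)
          (Ξ : W₂ ≃ₘ⟮𝓡∂ 4, 𝓡∂ 4⟯ Base g),
        CapSideTrace S h D bX Ψ DV Λ q' D₂ Ξ →
        TwoSidedStabModel M g l S) :
    ∀ (M : Type) [TopologicalSpace M] [T2Space M] [SecondCountableTopology M]
      [ChartedSpace (EuclideanSpace ℝ (Fin 4)) M] [IsManifold (𝓡 4) ∞ M] (g : ℕ) (l : IntWord g)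
      (c : Fin g ⊕ Fin g → ℤ) (S : StabBaseData g l.length c),
      NormalisedDatum M g l S →
      (∀ (V : Type) [TopologicalSpace V] [T2Space V] [SecondCountableTopology V] [CompactSpace V]
        [ChartedSpace (EuclideanHalfSpace 4) V] [IsManifold (𝓡∂ 4) ∞ V]
        (DV : MultiAttachmentData ![S.qA, S.qB] (𝓡∂ 4) V),
        ∃ Λ : V ≃ₘ⟮𝓡∂ 4, 𝓡∂ 4⟯ Base g,
          ∀ (a : ↥(coresComplement S.q1)) (ha : S.E.jA a ∈ coresComplement ![S.qA, S.qB]),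
            (a : Base g) ∉ modelRegion g l.length S.δ₀ S.ε₁ → Λ (DV.jA ⟨S.E.jA a, ha⟩) = (a : Base g)) →
      TwoSidedStabModel M g l S := by
  intro M _ _ _ _ _ g l c S hN hcancel
  obtain ⟨X, _, _, _, _, _, _, h, D, bX, Ψ, hW⟩ := (normalisedDatum_iff M g l S).1 hN
  -- one block model
  have hdisj : Pairwise fun i j => Disjoint (range (![S.qA, S.qB] i).toFun) (range (![S.qA, S.qB] j).toFun) := by
    intro i j hij
    fin_cases i <;> fin_cases j
    · exact absurd rfl hij
    · simpa using S.qAB_disjoint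
    · simpa using S.qAB_disjoint.symm
    · exact absurd rfl hij
  obtain ⟨V, _, _, _, hT2, h2nd, hcpt, hV⟩ := exists_isMultiAttachment_holds 3 2 (Base (g + 1))
    (Fin 2) ![S.qA, S.qB] hdisj
  haveI := hT2; haveI := h2nd; haveI : CompactSpace V := hcpt inferInstance
  obtain ⟨DV⟩ := hV.nonempty_multiAttachmentData
  obtain ⟨Λ, hΛ⟩ := hcancel V DV
  obtain ⟨X₁, _, _, _, _, _, _, hold, D₁, GX, hX₁⟩ := hB1 M g l c S X h D bX Ψ hW V DV Λ hΛ
  obtain ⟨W₂, _, _, _, _, _, _, q', D₂, Ξ, hW₂⟩ := hB2 M g l c S X h D bX Ψ hW V DV Λ hΛ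
  exact hB3 M g l c S X h D bX Ψ hW V DV Λ hΛ X₁ hold D₁ GX hX₁ W₂ q' D₂ Ξ hW₂

/-- **CONTRACT N3d-4/5/6 (short form): `node_trade` from (T1), (T2), (T3) stated through `DualisedModel`**
(pure chaining). [cite: Baykur2006, §5 p. 13] -/
theorem node_trade_of_short_subpieces
    (hT1 : ∀ (M : Type) [TopologicalSpace M] [T2Space M] [SecondCountableTopology M]
        [ChartedSpace (EuclideanSpace ℝ (Fin 4)) M] [IsManifold (𝓡 4) ∞ M] (g : ℕ) (l : IntWord g)
        (c : Fin g ⊕ Fin g → ℤ) (S : StabBaseData g l.length c),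
        TwoSidedStabModel M g l S →
        ∃ (ηA ηB : ℝ), 0 < ηA ∧ ηA < 4 * π / ((l.length + 4 : ℕ) : ℝ) ∧ 0 < ηB ∧
          ηB < 4 * π / ((l.length + 4 : ℕ) : ℝ) ∧
          DualisedModel M g l c ![pageDir (l.length + 4) 0,
            pageDir (l.length + 4) 0 * Complex.exp (((-ηA : ℝ) : ℂ) * Complex.I), pageDir (l.length + 4) 2,
            pageDir (l.length + 4) 2 * Complex.exp (((-ηB : ℝ) : ℂ) * Complex.I)])
    (hT2 : ∀ (M : Type) [TopologicalSpace M] [T2Space M] [SecondCountableTopology M]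
        [ChartedSpace (EuclideanSpace ℝ (Fin 4)) M] [IsManifold (𝓡 4) ∞ M] (g : ℕ) (l : IntWord g)
        (c : Fin g ⊕ Fin g → ℤ) (ηA ηB : ℝ),
        0 < ηA → ηA < 4 * π / ((l.length + 4 : ℕ) : ℝ) → 0 < ηB → ηB < 4 * π / ((l.length + 4 : ℕ) : ℝ) →
        DualisedModel M g l c ![pageDir (l.length + 4) 0,
            pageDir (l.length + 4) 0 * Complex.exp (((-ηA : ℝ) : ℂ) * Complex.I), pageDir (l.length + 4) 2,
            pageDir (l.length + 4) 2 * Complex.exp (((-ηB : ℝ) : ℂ) * Complex.I)] →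
        DualisedModel M g l c fun i => pageDir (l.length + 4) i)
    (hT3 : ∀ (M : Type) [TopologicalSpace M] [T2Space M] [SecondCountableTopology M]
        [ChartedSpace (EuclideanSpace ℝ (Fin 4)) M] [IsManifold (𝓡 4) ∞ M] (g : ℕ) (l : IntWord g)
        (c : Fin g ⊕ Fin g → ℤ),
        DualisedModel M g l c (fun i => pageDir (l.length + 4) i) → ModelsOnFibred M (g + 1) (natWord g c l)) :
    ∀ (M : Type) [TopologicalSpace M] [T2Space M] [SecondCountableTopology M]
      [ChartedSpace (EuclideanSpace ℝ (Fin 4)) M] [IsManifold (𝓡 4) ∞ M] (g : ℕ) (l : IntWord g)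
      (c : Fin g ⊕ Fin g → ℤ) (S : StabBaseData g l.length c),
      TwoSidedStabModel M g l S → ModelsOnFibred M (g + 1) (natWord g c l) := by
  intro M _ _ _ _ _ g l c S hTS
  obtain ⟨ηA, ηB, hA0, hA1, hB0, hB1, hdual⟩ := hT1 M g l c S hTS
  exact hT3 M g l c (hT2 M g l c ηA ηB hA0 hA1 hB0 hB1 hdual)

/-! ## Registered helper -/

/-- **Registered helper `helper_node_trade_of_short_subpieces` (sub-goal of `stub_STgeo` ▸ N3-nat ▸ N3d-4/5/6,
wave 8, lead c5): N3d-4/5/6 `node_trade` from the short forms of (T1) trade + re-dig, (T2) re-space,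
(T3) finish.** [cite: Baykur2006, §5 p. 13] -/
theorem helper_node_trade_of_short_subpieces : (∀ (M : Type) [TopologicalSpace M] [T2Space M] [SecondCountableTopology M] [ChartedSpace (EuclideanSpace ℝ (Fin 4)) M] [IsManifold (𝓡 4) ∞ M] (g : ℕ) (l : Literature.GroupTheory.CombinatorialGroupTheory.SignedHurwitz.IntWord g) (c : Fin g ⊕ Fin g → ℤ) (S : Summit.SmoothPoincare4.SmoothPoincare4.Theorems.AcyclicBisectionExists.ModpBraidOrbits.StabBaseData g l.length c), Summit.SmoothPoincare4.SmoothPoincare4.Theorems.AcyclicBisectionExists.ModpBraidOrbits.TwoSidedStabModel M g l S → ∃ (ηA ηB : ℝ), 0 < ηA ∧ ηA < 4 * Real.pi / ((l.length + 4 : ℕ) : ℝ) ∧ 0 < ηB ∧ ηB < 4 * Real.pi / ((l.length + 4 : ℕ) : ℝ) ∧ Summit.SmoothPoincare4.SmoothPoincare4.Theorems.AcyclicBisectionExists.ModpBraidOrbits.DualisedModel M g l c ![Literature.Topology.FourManifolds.LefschetzBase.pageDir (l.length + 4) 0, Literature.Topology.FourManifolds.LefschetzBase.pageDir (l.length + 4)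 0 * Complex.exp (((-ηA : ℝ) : ℂ) * Complex.I), Literature.Topology.FourManifolds.LefschetzBase.pageDir (l.length + 4) 2, Literature.Topology.FourManifolds.LefschetzBase.pageDir (l.length + 4) 2 * Complex.exp (((-ηB : ℝ) : ℂ) * Complex.I)]) → (∀ (M : Type) [TopologicalSpace M] [T2Space M] [SecondCountableTopology M] [ChartedSpace (EuclideanSpace ℝ (Fin 4)) M] [IsManifold (𝓡 4) ∞ M] (g : ℕ) (l : Literature.GroupTheory.CombinatorialGroupTheory.SignedHurwitz.IntWord g) (c : Fin g ⊕ Fin g → ℤ) (ηA ηB : ℝ), 0 < ηA → ηA < 4 * Real.pi / ((l.length + 4 : ℕ) : ℝ) → 0 < ηB → ηB < 4 * Real.pi / ((l.length + 4 : ℕ) : ℝ) → Summit.SmoothPoincare4.SmoothPoincare4.Theorems.AcyclicBisectionExists.ModpBraidOrbits.DualisedModel M g l c ![Literature.Topology.FourManifolds.LefschetzBase.pageDir (l.length + 4) 0, Literature.Topology.FourManifolds.LefschetzBase.pageDir (l.length + 4) 0 * Complex.exp (((-ηA : ℝ) : ℂ) * Complex.I), Literature.Topology.FourManifolds.LefschetzBase.pageDir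 (l.length + 4) 2, Literature.Topology.FourManifolds.LefschetzBase.pageDir (l.length + 4) 2 * Complex.exp (((-ηB : ℝ) : ℂ) * Complex.I)] → Summit.SmoothPoincare4.SmoothPoincare4.Theorems.AcyclicBisectionExists.ModpBraidOrbits.DualisedModel M g l c fun i => Literature.Topology.FourManifolds.LefschetzBase.pageDir (l.length + 4) i) → (∀ (M : Type) [TopologicalSpace M] [T2Space M] [SecondCountableTopology M] [ChartedSpace (EuclideanSpace ℝ (Fin 4)) M] [IsManifold (𝓡 4) ∞ M] (g : ℕ) (l : Literature.GroupTheory.CombinatorialGroupTheory.SignedHurwitz.IntWord g) (c : Fin g ⊕ Fin g → ℤ), Summit.SmoothPoincare4.SmoothPoincare4.Theorems.AcyclicBisectionExists.ModpBraidOrbits.DualisedModel M g l c (fun i => Literature.Topology.FourManifolds.LefschetzBase.pageDir (l.length + 4) i) → Literature.Topology.FourManifolds.LefschetzBase.ModelsOnFibred M (g + 1) (Summit.SmoothPoincare4.SmoothPoincare4.Theorems.AcyclicBisectionExists.ModpBraidOrbits.natWord g c l)) → ∀ (M : Type) [TopologicalSpace M] [T2Space M] [SecondCountableTopology M] [ChartedSpace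 (EuclideanSpace ℝ (Fin 4)) M] [IsManifold (𝓡 4) ∞ M] (g : ℕ) (l : Literature.GroupTheory.CombinatorialGroupTheory.SignedHurwitz.IntWord g) (c : Fin g ⊕ Fin g → ℤ) (S : Summit.SmoothPoincare4.SmoothPoincare4.Theorems.AcyclicBisectionExists.ModpBraidOrbits.StabBaseData g l.length c), Summit.SmoothPoincare4.SmoothPoincare4.Theorems.AcyclicBisectionExists.ModpBraidOrbits.TwoSidedStabModel M g l S → Literature.Topology.FourManifolds.LefschetzBase.ModelsOnFibred M (g + 1) (Summit.SmoothPoincare4.SmoothPoincare4.Theorems.AcyclicBisectionExists.ModpBraidOrbits.natWord g c l) :=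
  fun hT1 hT2 hT3 => node_trade_of_short_subpieces hT1 hT2 hT3

end Summit.SmoothPoincare4.SmoothPoincare4.Theorems.AcyclicBisectionExists.ModpBraidOrbits

end
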